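import Summits.ValiantsHypothesis.ValiantsHypothesis.Theorems.KPlusLogSqLawOctaveGlueWitness
import Summits.ValiantsHypothesis.ValiantsHypothesis.Theorems.LacunarySymmetroidPencilTransfer
import Summits.ValiantsHypothesis.ValiantsHypothesis.Theorems.LacunarySymmetroidMatrixDescartesStubArith4
import Summits.ValiantsHypothesis.ValiantsHypothesis.Theorems.MatrixDescartes.Negative.MatrixDescartesFalseOfTropicalMonster

/-!
# Route «KPlusLogSqLaw», octave line — GLUE (Theses-free): `TropicalB`-shape ∧ `OctaveWeakLifting`-shape ⇒ VP_ℂ ≠ VNP_ℂ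

HONEST FRAMING.  Theses-FREE twin of the octave line's deciding chain (prover seat val-width-19561-oc1, `--supports stmt-ValiantsHypothesis-19561`), written so that the ROUTE FILE `Theses/KPlusLogSqLaw.lean` can import it: the landed modules `…Theorems.KPlusLogSqLawOctave{Defs,Witness,…}` import `Theses.KPlusLogSqLaw` (for the names `TropicalB`/`WeakLifting`) and are therefore NOT importable by the route file (import cycle).  Here every hypothesis is written in the VERBATIM SHAPE of the route items (δ-equal to `Theses.KPlusLogSqLaw.TropicalB` and to the proposed item `OctaveWeakLifting`), and `octave`/`octaveCount` are re-declared in this namespace with the same bodies (`OctaveGlue.octaveCount = Octave.octaveCount` is `rfl`, proved in the coherence file `KPlusLogSqLawOctaveGlueCoherence`).  `TropicalB`, `WeakLifting`, Conjecture B and the octave statements are OPEN; the theorems here are IMPLICATIONS only; VP ≠ VNP is not moved.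

This file: the octave rows/laws as Theses-free Props with parameters (`OctaveRootLawAt m K B`, and the parameterless candidates
spelled out inline), the bridges `octaveKLaw_of_tropicalB_of_octaveWeakLifting`, `octaveMatrixDescartes_of_octaveKLaw`,
`valiant_of_octaveMatrixDescartes` (with the CLOSED `pencilTransfer_proof`, which transfers root SETS, hence octave counts) and the
deciding theorem **`valiant_of_tropicalB_of_octaveWeakLifting`** whose two binders are δ-equal to `Theses.KPlusLogSqLaw.TropicalB` and to
the proposed route item `OctaveWeakLifting` — so `theorem closes (hT : TropicalB) (hΩ : OctaveWeakLifting) : ValiantsHypothesis :=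
valiant_of_tropicalB_of_octaveWeakLifting hT hΩ` elaborates inside the route file.  READY-TO-PASTE item body for the custodian:
the second binder's type below, with `octaveCount` read as `Summit.ValiantsHypothesis.ValiantsHypothesis.Theorems.KPlusLogSqLaw.OctaveGlue.octaveCount`.
-/

set_option linter.dupNamespace false
set_option autoImplicit false

namespace Summit.ValiantsHypothesis.ValiantsHypothesis.Theorems.KPlusLogSqLaw.OctaveGlue

open Polynomial Finset
open scoped BigOperators
open Summit.ValiantsHypothesis.ValiantsHypothesis.Theses.LacunarySymmetroid (PencilTransfer)

/-- census row, octave form (Theses-free twin of `Octave.OctaveRootLawAt`, same body): every real symmetric lacunary pencil of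
format `(m, K)` has roots in at most `B` octaves. -/
def OctaveRootLawAt (m K B : ℕ) : Prop :=
  ∀ (d : Fin K → ℕ) (S : Fin K → Matrix (Fin m) (Fin m) ℝ), (∀ l, (S l).IsSymm) →
    octaveCount (Matrix.det (∑ l, ((Polynomial.X : Polynomial ℝ) ^ d l) • (S l).map Polynomial.C)) ≤ B

/-- Monotonicity of the octave law in the bound. [folklore] -/
theorem octaveRootLawAt_mono {m K B B' : ℕ} (hBB' : B ≤ B') (h : OctaveRootLawAt m K B) : OctaveRootLawAt m K B' :=
  fun d S hS => (h d S hS).trans hBB'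

/-- TB ∧ Ω-W ⇒ Ω-B (the three-line computation of p417903, octave form). [folklore] -/
theorem octaveKLaw_of_tropicalB_of_octaveWeakLifting
    (hT : (∃ C : ℕ, ∀ (m K : ℕ), ∀ (d : Fin K → ℕ) (v ε : Fin m → Fin m → Fin K → ℤ) (n : ℕ) (θ : Fin (n + 1) → ℤ)
      (p : Fin (n + 1) → Equiv.Perm (Fin m) × (Fin m → Fin K)), (∀ i j l, (ε i j l).natAbs ≤ 1) → StrictMono θ →
      (∀ k, Summit.ValiantsHypothesis.ValiantsHypothesis.Theorems.MatrixDescartes.Negative.IsDominant d v ε (θ k) (p k)) →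
      (∀ k : Fin n, Summit.ValiantsHypothesis.ValiantsHypothesis.Theorems.MatrixDescartes.Negative.termSign ε (p k.castSucc) *
        Summit.ValiantsHypothesis.ValiantsHypothesis.Theorems.MatrixDescartes.Negative.termSign ε (p k.succ) < 0) →
      n ≤ 2 ^ (C * (K + Nat.log 2 m ^ 2))))
    (hW : (∃ C : ℕ, ∀ (m K n : ℕ), (∀ (d : Fin K → ℕ) (v ε : Fin m → Fin m → Fin K → ℤ) (n' : ℕ) (θ : Fin (n' + 1) → ℤ)
      (p : Fin (n' + 1) → Equiv.Perm (Fin m) × (Fin m → Fin K)), (∀ i j l, (ε i j l).natAbs ≤ 1) → StrictMono θ →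
      (∀ k, Summit.ValiantsHypothesis.ValiantsHypothesis.Theorems.MatrixDescartes.Negative.IsDominant d v ε (θ k) (p k)) →
      (∀ k : Fin n', Summit.ValiantsHypothesis.ValiantsHypothesis.Theorems.MatrixDescartes.Negative.termSign ε (p k.castSucc) *
        Summit.ValiantsHypothesis.ValiantsHypothesis.Theorems.MatrixDescartes.Negative.termSign ε (p k.succ) < 0) → n' ≤ n) →
      ∀ (d : Fin K → ℕ) (S : Fin K → Matrix (Fin m) (Fin m) ℝ), (∀ l, (S l).IsSymm) →
        octaveCount (Matrix.det (∑ l, ((Polynomial.X : Polynomial ℝ) ^ d l) • (S l).map Polynomial.C))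
          ≤ 2 ^ (C * (K + Nat.log 2 m ^ 2)) * (n + 1))) :
    (∃ C : ℕ, ∀ m K : ℕ, OctaveRootLawAt m K (2 ^ (C * (K + Nat.log 2 m ^ 2)))) := by
  obtain ⟨CT, hT⟩ := hT
  obtain ⟨CW, hW⟩ := hW
  refine ⟨CW + CT + 1, fun m K => ?_⟩
  have h1 := hW m K (2 ^ (CT * (K + Nat.log 2 m ^ 2))) (hT m K)
  rcases Nat.eq_zero_or_pos K with hK | hK
  · subst hK
    intro d S _
    have h0 : (∑ l : Fin 0, ((Polynomial.X : Polynomial ℝ) ^ d l) • (S l).map Polynomial.C) = 0 := by simp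
    rw [h0]
    rcases Nat.eq_zero_or_pos m with hm | hm
    · subst hm
      have : octaveCount (Matrix.det (0 : Matrix (Fin 0) (Fin 0) ℝ[X])) ≤ (Matrix.det (0 : Matrix (Fin 0) (Fin 0) ℝ[X])).roots.toFinset.card :=
        octaveCount_le_card _
      simp [Matrix.det_isEmpty] at this ⊢
      rw [this]; exact Nat.zero_le _
    · haveI : Nonempty (Fin m) := ⟨⟨0, hm⟩⟩
      have : octaveCount (Matrix.det (0 : Matrix (Fin m) (Fin m) ℝ[X])) ≤ (Matrix.det (0 : Matrix (Fin m) (Fin m) ℝ[X])).roots.toFinset.card :=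
        octaveCount_le_card _
      simp [Matrix.det_zero] at this ⊢
      rw [this]; exact Nat.zero_le _
  · refine octaveRootLawAt_mono ?_ h1
    have e1 : 2 ^ (CT * (K + Nat.log 2 m ^ 2)) + 1 ≤ 2 ^ (CT * (K + Nat.log 2 m ^ 2) + 1) :=
      Nat.pow_lt_pow_right (by norm_num) (Nat.lt_succ_self _)
    calc 2 ^ (CW * (K + Nat.log 2 m ^ 2)) * (2 ^ (CT * (K + Nat.log 2 m ^ 2)) + 1)
        ≤ 2 ^ (CW * (K + Nat.log 2 m ^ 2)) * 2 ^ (CT * (K + Nat.log 2 m ^ 2) + 1) := Nat.mul_le_mul_left _ e1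
      _ = 2 ^ (CW * (K + Nat.log 2 m ^ 2) + (CT * (K + Nat.log 2 m ^ 2) + 1)) := (pow_add _ _ _).symm
      _ ≤ 2 ^ ((CW + CT + 1) * (K + Nat.log 2 m ^ 2)) :=
        Nat.pow_le_pow_right (by norm_num) (by nlinarith [hK, Nat.zero_le (Nat.log 2 m ^ 2)])

/-- Ω-B ⇒ Ω-MDR (the arithmetic of `Census.matrixDescartes_of_kPlusLogSqLaw`, octave form). [folklore] -/
theorem octaveMatrixDescartes_of_octaveKLaw (h : (∃ C : ℕ, ∀ m K : ℕ, OctaveRootLawAt m K (2 ^ (C * (K + Nat.log 2 m ^ 2))))) :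
    (∀ c q : ℕ, 0 < q → ∃ K₀ : ℕ, ∀ K m : ℕ, K₀ ≤ K → m ≤ 2 ^ ((Nat.log 2 K + c) ^ c) →
      ∀ (d : Fin K → ℕ) (S : Fin K → Matrix (Fin m) (Fin m) ℝ), (∀ l, (S l).IsSymm) →
        octaveCount (Matrix.det (∑ l, ((Polynomial.X : Polynomial ℝ) ^ d l) • (S l).map Polynomial.C)) ^ q
          ≤ 2 ^ (K * Nat.log 2 K)) := by
  obtain ⟨C, hC⟩ := h
  intro c q _hq
  obtain ⟨K₁, hK₁⟩ := Summit.ValiantsHypothesis.ValiantsHypothesis.Theorems.LacunarySymmetroidMatrixDescartes.StubArith4.exp_le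
    (2 * c) (2 * q * C)
  refine ⟨max K₁ (2 ^ (2 * q * C)), fun K m hK hm d S hS => ?_⟩
  have hK1 : K₁ ≤ K := le_of_max_le_left hK
  have hK2 : 2 ^ (2 * q * C) ≤ K := le_of_max_le_right hK
  have hL : 2 * q * C ≤ Nat.log 2 K := Nat.le_log_of_pow_le one_lt_two hK2
  have hlogm : Nat.log 2 m ≤ (Nat.log 2 K + c) ^ c :=
    calc Nat.log 2 m ≤ Nat.log 2 (2 ^ ((Nat.log 2 K + c) ^ c)) := Nat.log_mono_right hm
      _ = (Nat.log 2 K + c) ^ c := Nat.log_pow one_lt_two _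
  have hsq : Nat.log 2 m ^ 2 ≤ (Nat.log 2 K + 2 * c) ^ (2 * c) :=
    calc Nat.log 2 m ^ 2 ≤ ((Nat.log 2 K + c) ^ c) ^ 2 := Nat.pow_le_pow_left hlogm 2
      _ = (Nat.log 2 K + c) ^ (2 * c) := by rw [← pow_mul, mul_comm]
      _ ≤ (Nat.log 2 K + 2 * c) ^ (2 * c) := Nat.pow_le_pow_left (by omega) _
  have hZ := hC m K d S hS
  have h1 : 2 * q * C * (Nat.log 2 K + 2 * c) ^ (2 * c) ≤ K * Nat.log 2 K := hK₁ K hK1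
  have h2 : 2 * q * C * K ≤ K * Nat.log 2 K :=
    calc 2 * q * C * K = K * (2 * q * C) := by ring
      _ ≤ K * Nat.log 2 K := Nat.mul_le_mul_left K hL
  have hexp : q * (C * (K + Nat.log 2 m ^ 2)) ≤ K * Nat.log 2 K := by
    have h3 : q * C * Nat.log 2 m ^ 2 ≤ q * C * (Nat.log 2 K + 2 * c) ^ (2 * c) := Nat.mul_le_mul_left _ hsq
    have e1 : q * (C * (K + Nat.log 2 m ^ 2)) = q * C * K + q * C * Nat.log 2 m ^ 2 := by ring
    have e2 : 2 * q * C * (Nat.log 2 K + 2 * c) ^ (2 * c) = 2 * (q * C * (Nat.log 2 K + 2 * c) ^ (2 * c)) := by ring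
    have e3 : 2 * q * C * K = 2 * (q * C * K) := by ring
    rw [e2] at h1
    rw [e3] at h2
    omega
  calc octaveCount (Matrix.det (∑ l, ((Polynomial.X : Polynomial ℝ) ^ d l) • (S l).map Polynomial.C)) ^ q
      ≤ (2 ^ (C * (K + Nat.log 2 m ^ 2))) ^ q := Nat.pow_le_pow_left hZ q
    _ = 2 ^ (q * (C * (K + Nat.log 2 m ^ 2))) := by rw [← pow_mul, mul_comm]
    _ ≤ 2 ^ (K * Nat.log 2 K) := Nat.pow_le_pow_right (by norm_num) hexp

/-- Ω-MDR ∧ Ω-Θ ⇒ VP_ℂ ≠ VNP_ℂ, with the CLOSED `pencilTransfer_proof` (stmt-18051) — it transfers root SETS, hence `octaveCount`.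
(The arithmetic of route LacunarySymmetroid's `closes`, octave form.) [folklore] -/
theorem valiant_of_octaveMatrixDescartes (hMDR : (∀ c q : ℕ, 0 < q → ∃ K₀ : ℕ, ∀ K m : ℕ, K₀ ≤ K → m ≤ 2 ^ ((Nat.log 2 K + c) ^ c) →
      ∀ (d : Fin K → ℕ) (S : Fin K → Matrix (Fin m) (Fin m) ℝ), (∀ l, (S l).IsSymm) →
        octaveCount (Matrix.det (∑ l, ((Polynomial.X : Polynomial ℝ) ^ d l) • (S l).map Polynomial.C)) ^ q
          ≤ 2 ^ (K * Nat.log 2 K)))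
    (hW : (∃ (Θ : ∀ n : ℕ, MvPolynomial (Fin n) ℝ) (d : ∀ n : ℕ, Fin n → ℕ),
      Literature.Computability.AlgebraicComplexity.IsVNPFamily (fun n => MvPolynomial.map (algebraMap ℝ ℂ) (Θ n)) ∧
      ∃ n₀ : ℕ, ∀ n : ℕ, n₀ ≤ n →
        2 ^ (n * Nat.log 2 n) ≤ octaveCount (MvPolynomial.aeval (fun i => (Polynomial.X : Polynomial ℝ) ^ d n i) (Θ n)) + 1)) :
    _root_.ValiantsHypothesis := by
  have hT : PencilTransfer := Summit.ValiantsHypothesis.ValiantsHypothesis.Theorems.LacunarySymmetroid.pencilTransfer_proof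
  show Literature.Computability.AlgebraicComplexity.VP ℂ ≠ Literature.Computability.AlgebraicComplexity.VNP ℂ
  intro hEq
  obtain ⟨Θ, d, hVNP, n₀, hroots⟩ := hW
  have hVP : Literature.Computability.AlgebraicComplexity.IsVPFamily
      (fun n => MvPolynomial.map (algebraMap ℝ ℂ) (Θ n)) := by
    have hmem := (Literature.Computability.AlgebraicComplexity.mem_VNP_ofFintype_iff_holds _).2 hVNP
    rw [← hEq] at hmem
    exact (Literature.Computability.AlgebraicComplexity.mem_VP_ofFintype_iff_holds _).1 hmem
  obtain ⟨c, hc⟩ := hT (fun n => n) Θ hVP d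
  obtain ⟨K₀, hK⟩ := hMDR c 4 (by norm_num)
  obtain ⟨n, hn₀, hnK, hn4⟩ : ∃ n, n₀ ≤ n ∧ K₀ ≤ n ∧ 4 ≤ n := ⟨n₀ + K₀ + 4, by omega, by omega, by omega⟩
  obtain ⟨m, hm, S, hS, hroot⟩ := hc n
  set Z := octaveCount (MvPolynomial.aeval (fun i => (Polynomial.X : Polynomial ℝ) ^ d n i) (Θ n)) with hZ
  have hm' : m ≤ 2 ^ ((Nat.log 2 (n + 1) + c) ^ c) :=
    hm.trans (Nat.pow_le_pow_right (by norm_num)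
      (Nat.pow_le_pow_left (Nat.add_le_add_right (Nat.log_mono_right (Nat.le_succ n)) c) c))
  have h1 := hK (n + 1) m (by omega) hm' (Fin.cons (α := fun _ => ℕ) (0 : ℕ) (d n)) S hS
  have hZeq : octaveCount (Matrix.det (∑ l, ((Polynomial.X : Polynomial ℝ) ^ (Fin.cons (α := fun _ => ℕ) (0 : ℕ) (d n) l)) •
      (S l).map Polynomial.C)) = Z := by
    rw [hZ, octaveCount, octaveCount, hroot]
  rw [hZeq] at h1
  have h2 : 2 ^ (n * Nat.log 2 n) ≤ Z + 1 := hroots n hn₀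
  set L := Nat.log 2 n with hL
  have hL2 : 2 ≤ L := by
    rw [hL]
    calc 2 = Nat.log 2 4 := by decide
      _ ≤ Nat.log 2 n := Nat.log_mono_right hn4
  have hLn : L ≤ n := by rw [hL]; exact Nat.log_le_self 2 n
  have hL' : Nat.log 2 (n + 1) ≤ L + 1 := by
    rw [hL]
    calc Nat.log 2 (n + 1) ≤ Nat.log 2 (n * 2) := Nat.log_mono_right (by omega)
      _ = Nat.log 2 n + 1 := Nat.log_mul_base (by norm_num) (by omega)
  have h3 : Z ^ 4 ≤ 2 ^ ((n + 1) * (L + 1)) :=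
    h1.trans (Nat.pow_le_pow_right (by norm_num) (Nat.mul_le_mul_left _ hL'))
  have hnL : 1 ≤ n * L := by nlinarith
  have h4 : 2 ^ (n * L - 1) ≤ Z := by
    have e : 2 ^ (n * L) = 2 * 2 ^ (n * L - 1) := by
      rw [← Nat.pow_succ']
      congr 1
      omega
    have h2' := h2
    rw [e] at h2'
    have : 1 ≤ 2 ^ (n * L - 1) := Nat.one_le_two_pow
    omega
  have h5 : 2 ^ (4 * (n * L - 1)) ≤ Z ^ 4 := by
    rw [pow_mul']
    exact Nat.pow_le_pow_left h4 4
  have h6 : 4 * (n * L - 1) ≤ (n + 1) * (L + 1) :=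
    (Nat.pow_le_pow_iff_right (by norm_num)).1 (h5.trans h3)
  have h7 : 6 * n ≤ 3 * (n * L) := by nlinarith
  have h6' : 4 * (n * L - 1) ≤ n * L + n + L + 1 := by
    have e : (n + 1) * (L + 1) = n * L + n + L + 1 := by ring
    rw [e] at h6
    exact h6
  generalize hP : n * L = P at h6' h7 hnL
  omega

/-- **GLUE: TB-shape ∧ Ω-W-shape ⇒ VP_ℂ ≠ VNP_ℂ** (Theses-free; binders δ-equal to `Theses.KPlusLogSqLaw.TropicalB` and to the proposed
item `OctaveWeakLifting`).  Usage inside the route file: `theorem closes (hT : TropicalB) (hΩ : OctaveWeakLifting) :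
_root_.ValiantsHypothesis := Summit.ValiantsHypothesis.ValiantsHypothesis.Theorems.KPlusLogSqLaw.OctaveGlue.valiant_of_tropicalB_of_octaveWeakLifting hT hΩ`. -/
theorem valiant_of_tropicalB_of_octaveWeakLifting
    (hT : (∃ C : ℕ, ∀ (m K : ℕ), ∀ (d : Fin K → ℕ) (v ε : Fin m → Fin m → Fin K → ℤ) (n : ℕ) (θ : Fin (n + 1) → ℤ)
      (p : Fin (n + 1) → Equiv.Perm (Fin m) × (Fin m → Fin K)), (∀ i j l, (ε i j l).natAbs ≤ 1) → StrictMono θ →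
      (∀ k, Summit.ValiantsHypothesis.ValiantsHypothesis.Theorems.MatrixDescartes.Negative.IsDominant d v ε (θ k) (p k)) →
      (∀ k : Fin n, Summit.ValiantsHypothesis.ValiantsHypothesis.Theorems.MatrixDescartes.Negative.termSign ε (p k.castSucc) *
        Summit.ValiantsHypothesis.ValiantsHypothesis.Theorems.MatrixDescartes.Negative.termSign ε (p k.succ) < 0) →
      n ≤ 2 ^ (C * (K + Nat.log 2 m ^ 2))))
    (hΩ : (∃ C : ℕ, ∀ (m K n : ℕ), (∀ (d : Fin K → ℕ) (v ε : Fin m → Fin m → Fin K → ℤ) (n' : ℕ) (θ : Fin (n' + 1) → ℤ)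
      (p : Fin (n' + 1) → Equiv.Perm (Fin m) × (Fin m → Fin K)), (∀ i j l, (ε i j l).natAbs ≤ 1) → StrictMono θ →
      (∀ k, Summit.ValiantsHypothesis.ValiantsHypothesis.Theorems.MatrixDescartes.Negative.IsDominant d v ε (θ k) (p k)) →
      (∀ k : Fin n', Summit.ValiantsHypothesis.ValiantsHypothesis.Theorems.MatrixDescartes.Negative.termSign ε (p k.castSucc) *
        Summit.ValiantsHypothesis.ValiantsHypothesis.Theorems.MatrixDescartes.Negative.termSign ε (p k.succ) < 0) → n' ≤ n) →
      ∀ (d : Fin K → ℕ) (S : Fin K → Matrix (Fin m) (Fin m) ℝ), (∀ l, (S l).IsSymm) →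
        octaveCount (Matrix.det (∑ l, ((Polynomial.X : Polynomial ℝ) ^ d l) • (S l).map Polynomial.C))
          ≤ 2 ^ (C * (K + Nat.log 2 m ^ 2)) * (n + 1))) :
    _root_.ValiantsHypothesis :=
  valiant_of_octaveMatrixDescartes (octaveMatrixDescartes_of_octaveKLaw (octaveKLaw_of_tropicalB_of_octaveWeakLifting hT hΩ))
    octaveThetaWitness

end Summit.ValiantsHypothesis.ValiantsHypothesis.Theorems.KPlusLogSqLaw.OctaveGlue
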